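import Mathlib

/-!
# The Nash–Stipsicz 2-knot group `⟨x, y | x y x y x⁻¹ y⁻¹ x y⁻¹ x⁻¹ y⁻¹⟩` is not solvable

Solo artefact (unit `solo-SmoothPoincare4-informed`), calibration fact for the fusion-number-one
instance problem of the Schoenflies-ball conjunct.

Nash–Stipsicz (D. Nash, A. Stipsicz, *Gluck twist on a certain family of 2-knots*,
Michigan Math. J. 61 (2012), arXiv:1103.5571, Proposition 4.2) build 2-knots
`K²_{pq} = (D⁴, D(p,q)₁) ∪ (D⁴, D(p,q)₂)‾ ⊂ S⁴` from the two fusion-number-one ribbon discs of the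
ribbon knot `K(p,q)` (`K(1,−1) = 8₉`) and compute `π₁(S⁴ ∖ K²_{pq}) ≅ ⟨x, y | r_{pq}⟩`; for `p, q` odd
the relator is `r = x y x y x⁻¹ y⁻¹ x y⁻¹ x⁻¹ y⁻¹` and the Alexander polynomial is
`1 − t + 2t² − t³`, which is also the Alexander polynomial `det(tI − A)` of the Cappell–Shaneson /
Aitchison–Rubinstein fibred 2-knot with fibre `T³ ∖ B³` and monodromy
`A = [[0,1,0],[0,1,1],[1,0,1]]`, whose group is the polycyclic (hence solvable) group `ℤ³ ⋊_A ℤ`.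

We certify in the kernel that the abstract one-relator group `G_NS = ⟨x, y | r⟩` is **not solvable**:
the assignment `x ↦ (2 3 4 5 6)`, `y ↦ (0 1 2 4 5)` in `S₇` kills `r`, and inside the image the
element `x̄` satisfies `x̄ = z̄ ⁅x̄, ȳ x̄ ȳ⁻¹ · x̄ · (ȳ x̄ ȳ⁻¹)⁻¹⁆ z̄⁻¹` with `z̄ = ȳ x̄ ȳ⁻² x̄⁻¹ ȳ⁻¹`,
so `x̄ ≠ 1` lies in every term of the derived series of the image (the argument of
`Equiv.Perm.fin_5_not_solvable`).  Consequently `G_NS` is not isomorphic to any solvable group, in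
particular to no semidirect product `N ⋊ C` of abelian groups such as `ℤ³ ⋊_A ℤ`: granting the
Nash–Stipsicz presentation, `K²_{1,−1}` is not a Cappell–Shaneson 2-knot although it is assembled
from two fusion-number-one ribbon discs of `8₉` and has the Cappell–Shaneson Alexander polynomial.
(Outside the kernel: a brute-force count gives `|Hom(G_NS, A₇)| = 15120` with `5040` surjections, and
no surjection onto `A₅, S₅, PSL(2,7), A₆, S₆, PSL(2,8), PSL(2,11), PSL(2,13)`.)

## Contents
* `NashStipsicz.nsRelator`, `NashStipsicz.NSGroup` — the relator and `G_NS` as a `PresentedGroup`.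
* `NashStipsicz.rep : NSGroup →* Equiv.Perm (Fin 7)` — the representation.
* `NashStipsicz.not_isSolvable_range_rep`, `NashStipsicz.not_isSolvable` — non-solvability.
* `NashStipsicz.isEmpty_mulEquiv_of_isSolvable`, `NashStipsicz.isEmpty_mulEquiv_semidirectProduct`
  — `G_NS` is isomorphic to no solvable group and to no abelian-by-abelian semidirect product.
-/

namespace Summit.SmoothPoincare4.SmoothPoincare4.Theorems

namespace NashStipsicz

open Equiv
open scoped commutatorElement

/-- The Nash–Stipsicz relator `r = x y x y x⁻¹ y⁻¹ x y⁻¹ x⁻¹ y⁻¹` (`x = of 0`, `y = of 1`). -/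
def nsRelator : FreeGroup (Fin 2) :=
  FreeGroup.of 0 * FreeGroup.of 1 * FreeGroup.of 0 * FreeGroup.of 1 * (FreeGroup.of 0)⁻¹ *
    (FreeGroup.of 1)⁻¹ * FreeGroup.of 0 * (FreeGroup.of 1)⁻¹ * (FreeGroup.of 0)⁻¹ *
    (FreeGroup.of 1)⁻¹

/-- The Nash–Stipsicz group `G_NS = ⟨x, y | x y x y x⁻¹ y⁻¹ x y⁻¹ x⁻¹ y⁻¹⟩`. -/
abbrev NSGroup : Type := PresentedGroup ({nsRelator} : Set (FreeGroup (Fin 2)))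

/-- `x̄ =` the 5-cycle `(2 3 4 5 6)` of `Fin 7`. -/
def permX : Perm (Fin 7) := ⟨![0, 1, 3, 4, 5, 6, 2], ![0, 1, 6, 2, 3, 4, 5], by decide, by decide⟩

/-- `ȳ =` the 5-cycle `(0 1 2 4 5)` of `Fin 7`. -/
def permY : Perm (Fin 7) := ⟨![1, 2, 4, 3, 5, 0, 6], ![5, 0, 1, 3, 2, 4, 6], by decide, by decide⟩

/-- The relator evaluated on `(x̄, ȳ)`. -/
def permR : Perm (Fin 7) :=
  permX * permY * permX * permY * permX⁻¹ * permY⁻¹ * permX * permY⁻¹ * permX⁻¹ * permY⁻¹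

/-- `r(x̄, ȳ) = 1` in `S₇`. -/
theorem permR_eq_one : permR = 1 := by decide

/-- The generator assignment `x ↦ x̄`, `y ↦ ȳ`. -/
def permGen : Fin 2 → Perm (Fin 7) := fun i => if i = 0 then permX else permY

/-- `FreeGroup.lift permGen` evaluates the relator to `permR`. -/
theorem lift_permGen_nsRelator : FreeGroup.lift permGen nsRelator = permR := by
  simp [nsRelator, permR, permGen, map_mul, map_inv]

/-- The representation `ρ : G_NS → S₇`, `x ↦ (2 3 4 5 6)`, `y ↦ (0 1 2 4 5)`. -/
def rep : NSGroup →* Perm (Fin 7) :=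
  PresentedGroup.toGroup (f := permGen) (by
    intro r hr
    rw [Set.mem_singleton_iff] at hr
    subst hr
    rw [lift_permGen_nsRelator, permR_eq_one])

/-- `ρ(x) = x̄`. -/
theorem rep_of_zero : rep (PresentedGroup.of (0 : Fin 2)) = permX := by
  simp [rep, permGen]

/-- `ρ(y) = ȳ`. -/
theorem rep_of_one : rep (PresentedGroup.of (1 : Fin 2)) = permY := by
  simp [rep, permGen]

/-- `x̂ = ρ(x)` as an element of the image group `ρ(G_NS) ≤ S₇`. -/
noncomputable def elemX : rep.range := rep.rangeRestrict (PresentedGroup.of (0 : Fin 2))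

/-- `ŷ = ρ(y)` as an element of the image group. -/
noncomputable def elemY : rep.range := rep.rangeRestrict (PresentedGroup.of (1 : Fin 2))

/-- `ẑ = ŷ x̂ ŷ⁻¹ ŷ⁻¹ x̂⁻¹ ŷ⁻¹`, the conjugator in the key identity. -/
noncomputable def elemZ : rep.range := elemY * elemX * elemY⁻¹ * elemY⁻¹ * elemX⁻¹ * elemY⁻¹

/-- `x̂` coerces to `x̄` in `S₇`. -/
@[simp] theorem coe_elemX : (elemX : Perm (Fin 7)) = permX := by
  simp [elemX, rep_of_zero]

/-- `ŷ` coerces to `ȳ` in `S₇`. -/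
@[simp] theorem coe_elemY : (elemY : Perm (Fin 7)) = permY := by
  simp [elemY, rep_of_one]

/-- `x̂ ≠ 1`. -/
theorem elemX_ne_one : elemX ≠ 1 := by
  intro h
  have h' := congrArg (fun g : rep.range => (g : Perm (Fin 7))) h
  simp only [coe_elemX, OneMemClass.coe_one] at h'
  exact absurd h' (by decide)

/-- The key identity `x̂ = ẑ ⁅x̂, (ŷ x̂ ŷ⁻¹) x̂ (ŷ x̂ ŷ⁻¹)⁻¹⁆ ẑ⁻¹` in the image group (checked in `S₇`). -/
theorem elemX_eq_conj_commutator :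
    elemX = elemZ * ⁅elemX, (elemY * elemX * elemY⁻¹) * elemX * (elemY * elemX * elemY⁻¹)⁻¹⁆ *
      elemZ⁻¹ := by
  apply Subtype.ext
  simp only [elemZ, commutatorElement_def, Subgroup.coe_mul, InvMemClass.coe_inv, coe_elemX,
    coe_elemY]
  decide

/-- `x̂` lies in every term of the derived series of the image group. -/
theorem elemX_mem_derivedSeries (n : ℕ) : elemX ∈ derivedSeries rep.range n := by
  induction n with
  | zero => exact Subgroup.mem_top _
  | succ n ih =>
    rw [elemX_eq_conj_commutator, (derivedSeries_normal _ _).mem_comm_iff, inv_mul_cancel_left]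
    exact Subgroup.commutator_mem_commutator ih
      ((derivedSeries_normal _ _).conj_mem _ ih _)

/-- The image `ρ(G_NS) ≤ S₇` is not solvable. -/
theorem not_isSolvable_range_rep : ¬ IsSolvable rep.range :=
  not_solvable_of_mem_derivedSeries elemX_ne_one elemX_mem_derivedSeries

/-- **The Nash–Stipsicz group `⟨x, y | x y x y x⁻¹ y⁻¹ x y⁻¹ x⁻¹ y⁻¹⟩` is not solvable.** -/
theorem not_isSolvable : ¬ IsSolvable NSGroup := fun _ =>
  not_isSolvable_range_rep (solvable_of_surjective (MonoidHom.rangeRestrict_surjective rep))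

/-- `G_NS` is isomorphic to no solvable group. -/
theorem isEmpty_mulEquiv_of_isSolvable (H : Type*) [Group H] [IsSolvable H] :
    IsEmpty (NSGroup ≃* H) :=
  ⟨fun e => not_isSolvable (solvable_of_solvable_injective (f := e.toMonoidHom) e.injective)⟩

/-- A semidirect product of solvable groups is solvable. -/
theorem isSolvable_semidirectProduct {N C : Type*} [Group N] [Group C] (φ : C →* MulAut N)
    [IsSolvable N] [IsSolvable C] : IsSolvable (N ⋊[φ] C) :=
  solvable_of_ker_le_range (SemidirectProduct.inl : N →* N ⋊[φ] C) SemidirectProduct.rightHom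
    (by rw [SemidirectProduct.range_inl_eq_ker_rightHom])

/-- `G_NS` is isomorphic to no semidirect product `N ⋊_φ C` of abelian groups — in particular to no
Cappell–Shaneson group `ℤ³ ⋊_A ℤ` (take `N = Multiplicative (Fin 3 → ℤ)`, `C = Multiplicative ℤ`). -/
theorem isEmpty_mulEquiv_semidirectProduct {N C : Type*} [CommGroup N] [CommGroup C]
    (φ : C →* MulAut N) : IsEmpty (NSGroup ≃* N ⋊[φ] C) :=
  haveI := isSolvable_semidirectProduct φ
  isEmpty_mulEquiv_of_isSolvable (N ⋊[φ] C)

/-- The Cappell–Shaneson instance spelled out: for every action `φ` of `ℤ` on `ℤ³`,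
`G_NS ≇ ℤ³ ⋊_φ ℤ`. -/
theorem isEmpty_mulEquiv_int3_semidirect_int
    (φ : Multiplicative ℤ →* MulAut (Multiplicative (Fin 3 → ℤ))) :
    IsEmpty (NSGroup ≃* Multiplicative (Fin 3 → ℤ) ⋊[φ] Multiplicative ℤ) :=
  isEmpty_mulEquiv_semidirectProduct φ

end NashStipsicz

end Summit.SmoothPoincare4.SmoothPoincare4.Theorems
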